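import Literature.Computability.Complexity.BlockSensitivity
import HarnessLib

/-!
# Beals et al. Lemma 5.3: `D(f) ≤ C⁽¹⁾(f) · bs(f)`, and `D(f) ≤ bs(f)³`

Beals–Buhrman–Cleve–Mosca–de Wolf, *Quantum lower bounds by polynomials*, J. ACM 48 (2001), §5,
the decision-tree half of the proof of their Theorem 5.4 (`D(f) ≤ 4096 Q₂(f)⁶`), following
Nisan (*CREW PRAMs and decision trees*, 1991); also Buhrman–de Wolf, *Complexity measures and
decision tree complexity: a survey*, TCS 288 (2002), Theorem 11 and Corollary 1.

* **Lemma 5.3** (`detQueryComplexity_le_oneCertificateComplexity_mul_blockSensitivity`):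
  "`D(f) ≤ C⁽¹⁾(f) bs(f)`."
* **Corollary** (`detQueryComplexity_le_blockSensitivity_pow_three`; Beals et al. p. 11, "The
  previous two lemmas imply `D(f) ≤ bs(f)³`"; Buhrman–de Wolf Cor. 1), using Nisan's
  `C⁽¹⁾(f) ≤ C(f) ≤ bs(f)²` from `BlockSensitivity.lean`.

**The printed algorithm** (Lemma 5.3, proof): "Repeat the following at most `bs(f)` times: Pick
a consistent `1`-certificate `C` and query those of its variables whose `X`-values are still
unknown (if there is no such `C`, then return `0` and stop); if the queried values agree with `C`
then return `1` and stop. Pick a consistent `Y ∈ {0,1}^N` and return `f(Y)`. The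
nondeterministic 'pick a `C`' and 'pick a `Y`' can easily be made deterministic by choosing the
first `C` resp. `Y` in some fixed order."

Here (namespace `CertificateAlgorithm`): the knowledge of the algorithm is a partial assignment
`ρ : Fin N → Option Bool`; "consistent" is `Consistent y ρ`; the `1`-certificate picked is a
smallest certificate `minCert f z` of a chosen consistent `1`-input `z` (so it has
`C_z(f) ≤ C⁽¹⁾(f)` variables, and it is consistent because `z` is); its variables are queried by
the block query `queryBlock` (all of them — re-querying a known variable is harmless for the
depth bound); the consistent `Y` of the last step is `fill ρ` (unknown bits set to `0`, the first
consistent input in the lexicographic order). The decision tree is `roundTree f r ρ` (`r` rounds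
left), of depth `≤ r · C⁽¹⁾(f)` (`depth_roundTree_le`).

**The printed correctness proof** ("all consistent `Y` must have the same `f`-value. Suppose
not. Then there are consistent `Y, Y'` with `f(Y) = 0` and `f(Y') = 1` … define `B_i` as the
set of variables on which `Y` and `C_i` disagree … `f(Y^{B_i}) = 1` … all `B_i` and `B_j` are
disjoint. But then `f` is sensitive to `bs(f)+1` disjoint sets on `Y`, which is a
contradiction") is organised as an invariant `RoundInv f r ρ` maintained down the tree
(`eval_roundTree`): every consistent `0`-input `Y` has at most `r` pairwise disjoint sensitive
blocks avoiding the known variables. Each unsuccessful round adds, for every such `Y`, the fresh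
sensitive block `B = {v ∈ C : Y(v) ≠ C(v)}` inside the newly queried variables, so the bound
drops by one; with `0` rounds left a consistent `0`-input and a consistent `1`-input would give
one more block (their difference set), so all consistent inputs have the same value.

## References

* R. Beals, H. Buhrman, R. Cleve, M. Mosca, R. de Wolf, *Quantum lower bounds by polynomials*,
  J. ACM 48 (2001) 778–797, Lemma 5.3 and the remark following it (arXiv:quant-ph/9802049,
  pp. 10–11) [BealsEtAl2001].
* H. Buhrman, R. de Wolf, *Complexity measures and decision tree complexity: a survey*,
  Theoret. Comput. Sci. 288 (2002) 21–43, Theorem 11, Corollary 1 [BuhrmanDewolf2002].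
* N. Nisan, *CREW PRAMs and decision trees*, SIAM J. Comput. 20 (1991) 999–1007 (original
  source of the algorithm).
-/

namespace Literature.Computability.Complexity

open Finset DecisionTree

variable {N : ℕ}

namespace CertificateAlgorithm

/-! ### Partial knowledge of the input -/

/-- `y` is consistent with the partial assignment `ρ` of known values ("a `Y` that agrees with
the values of all variables queried up to that point"). [cite: BealsEtAl2001, Lemma 5.3 (proof)] -/
def Consistent (y : Fin N → Bool) (ρ : Fin N → Option Bool) : Prop :=
  ∀ i b, ρ i = some b → y i = b

/-- The set of variables whose value is known. [cite: BealsEtAl2001, Lemma 5.3 (proof)] -/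
def knownSet (ρ : Fin N → Option Bool) : Finset (Fin N) :=
  Finset.univ.filter fun i => (ρ i).isSome

/-- Record the values of `x` on the variables of the list `L`. [folklore] -/
def assign (x : Fin N → Bool) (L : List (Fin N)) (ρ : Fin N → Option Bool) : Fin N → Option Bool :=
  fun i => if i ∈ L then some (x i) else ρ i

/-- The first consistent input: unknown variables are set to `0` ("choosing the first `Y` in some
fixed order"). [cite: BealsEtAl2001, Lemma 5.3 (proof)] -/
def fill (ρ : Fin N → Option Bool) : Fin N → Bool := fun i => (ρ i).getD false

/-- `fill ρ` is consistent with `ρ`. [folklore] -/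
theorem consistent_fill (ρ : Fin N → Option Bool) : Consistent (fill ρ) ρ := fun i b h => by
  simp [fill, h]

/-- Nothing is known initially, so every input is consistent. [folklore] -/
theorem consistent_none (y : Fin N → Bool) : Consistent y (fun _ => none) := fun _ _ h => by
  simp at h

/-- Two consistent inputs agree on the known variables. [folklore] -/
theorem Consistent.eq_of_mem_knownSet {y z : Fin N → Bool} {ρ : Fin N → Option Bool}
    (hy : Consistent y ρ) (hz : Consistent z ρ) {i : Fin N} (hi : i ∈ knownSet ρ) : y i = z i := by
  obtain ⟨b, hb⟩ := Option.isSome_iff_exists.mp (Finset.mem_filter.mp hi).2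
  rw [hy i b hb, hz i b hb]

/-- The input itself is consistent with the knowledge recorded from it. [folklore] -/
theorem consistent_assign_self {x : Fin N → Bool} {ρ : Fin N → Option Bool} (hx : Consistent x ρ)
    (L : List (Fin N)) : Consistent x (assign x L ρ) := by
  intro i b h
  by_cases hi : i ∈ L
  · simpa [assign, hi] using h
  · exact hx i b (by simpa [assign, hi] using h)

/-- Consistency with more knowledge implies consistency with less. [folklore] -/
theorem Consistent.of_assign {x y : Fin N → Bool} {ρ : Fin N → Option Bool} {L : List (Fin N)}
    (hy : Consistent y (assign x L ρ)) (hx : Consistent x ρ) : Consistent y ρ := by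
  intro i b h
  by_cases hi : i ∈ L
  · rw [hy i (x i) (by simp [assign, hi]), hx i b h]
  · exact hy i b (by simp [assign, hi, h])

/-- An input consistent with the recorded values of `x` on `L` agrees with `x` on `L`. [folklore] -/
theorem Consistent.eq_of_mem {x y : Fin N → Bool} {ρ : Fin N → Option Bool} {L : List (Fin N)}
    (hy : Consistent y (assign x L ρ)) {i : Fin N} (hi : i ∈ L) : y i = x i :=
  hy i (x i) (by simp [assign, hi])

/-- Recording values only enlarges the known set. [folklore] -/
theorem knownSet_subset_assign (x : Fin N → Bool) (L : List (Fin N)) (ρ : Fin N → Option Bool) :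
    knownSet ρ ⊆ knownSet (assign x L ρ) := by
  intro i hi
  simp only [knownSet, Finset.mem_filter, Finset.mem_univ, true_and, assign] at hi ⊢
  split_ifs
  · rfl
  · exact hi

/-- The queried variables become known. [folklore] -/
theorem mem_knownSet_assign {x : Fin N → Bool} {L : List (Fin N)} {ρ : Fin N → Option Bool}
    {i : Fin N} (hi : i ∈ L) : i ∈ knownSet (assign x L ρ) := by
  simp [knownSet, assign, hi]

/-! ### Querying a block of variables -/

/-- Query the variables of the list `L` in order, recording the answers in the knowledge `ρ`, then
continue with the tree `k ρ'` chosen according to the updated knowledge `ρ'` ("query those of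
its variables …"). [cite: BealsEtAl2001, Lemma 5.3 (proof)] -/
def queryBlock : List (Fin N) → (Fin N → Option Bool) →
    ((Fin N → Option Bool) → DecisionTree N) → DecisionTree N
  | [], ρ, k => k ρ
  | i :: L, ρ, k =>
    query i (queryBlock L (Function.update ρ i (some false)) k)
      (queryBlock L (Function.update ρ i (some true)) k)

/-- Recording the values one variable at a time. [folklore] -/
theorem assign_cons (x : Fin N → Bool) (i : Fin N) (L : List (Fin N)) (ρ : Fin N → Option Bool) :
    assign x (i :: L) ρ = assign x L (Function.update ρ i (some (x i))) := by
  funext j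
  by_cases hj : j = i
  · subst hj
    simp [assign]
  · simp [assign, hj]

/-- On input `x`, the block query continues with the knowledge updated by the values of `x`.
[folklore] -/
theorem eval_queryBlock (x : Fin N → Bool) :
    ∀ (L : List (Fin N)) (ρ : Fin N → Option Bool) (k : (Fin N → Option Bool) → DecisionTree N),
      (queryBlock L ρ k).eval x = (k (assign x L ρ)).eval x
  | [], ρ, k => by
    have : assign x [] ρ = ρ := funext fun i => by simp [assign]
    rw [queryBlock, this]
  | i :: L, ρ, k => by
    rw [queryBlock, eval_query, assign_cons]
    cases hxi : x i
    · simpa using eval_queryBlock x L (Function.update ρ i (some false)) k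
    · simpa using eval_queryBlock x L (Function.update ρ i (some true)) k

/-- The block query adds the number of queried variables to the depth. [folklore] -/
theorem depth_queryBlock_le {d : ℕ} :
    ∀ (L : List (Fin N)) (ρ : Fin N → Option Bool) (k : (Fin N → Option Bool) → DecisionTree N),
      (∀ ρ', (k ρ').depth ≤ d) → (queryBlock L ρ k).depth ≤ L.length + d
  | [], ρ, k, hk => by simpa [queryBlock] using hk ρ
  | i :: L, ρ, k, hk => by
    simp only [queryBlock, depth_query, List.length_cons]
    have h0 := depth_queryBlock_le L (Function.update ρ i (some false)) k hk
    have h1 := depth_queryBlock_le L (Function.update ρ i (some true)) k hk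
    omega

/-! ### The algorithm -/

/-- A smallest certificate of `z` (size `C_z(f)`), the `1`-certificate picked in a round when `z`
is the chosen consistent `1`-input. [cite: BealsEtAl2001, Lemma 5.3 (proof)] -/
noncomputable def minCert (f : (Fin N → Bool) → Bool) (z : Fin N → Bool) : Finset (Fin N) :=
  Classical.choose (exists_certificate_card_eq f z)

/-- `minCert f z` is a certificate of `z` of size `C_z(f)`. [cite: BealsEtAl2001, Def 5.1] -/
theorem minCert_spec (f : (Fin N → Bool) → Bool) (z : Fin N → Bool) :
    IsCertificate f z (minCert f z) ∧ (minCert f z).card = certificateComplexityAt f z :=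
  Classical.choose_spec (exists_certificate_card_eq f z)

open Classical in
/-- After the variables of the certificate of `z` have been queried: "if the queried values
agree with `C` then return `1` and stop", else continue with `t`. [cite: BealsEtAl2001, Lemma 5.3
(proof)] -/
noncomputable def afterRound (f : (Fin N → Bool) → Bool) (z : Fin N → Bool)
    (t : (Fin N → Option Bool) → DecisionTree N) (ρ' : Fin N → Option Bool) : DecisionTree N :=
  if ∀ i ∈ minCert f z, ρ' i = some (z i) then leaf true else t ρ'

open Classical in
/-- The algorithm **A** of Lemma 5.3 with `r` rounds left and knowledge `ρ`, as a decision tree: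
with no round left, return `f` of the first consistent input; otherwise, if some consistent
input has value `1`, query the variables of a smallest certificate of (a chosen) such input,
return `1` if the answers agree with it and recurse otherwise; if no consistent input has value
`1`, return `0`. [cite: BealsEtAl2001, Lemma 5.3 (proof)] -/
noncomputable def roundTree (f : (Fin N → Bool) → Bool) : ℕ → (Fin N → Option Bool) → DecisionTree N
  | 0, ρ => leaf (f (fill ρ))
  | r + 1, ρ =>
    if h : ∃ z, Consistent z ρ ∧ f z = true then
      queryBlock (minCert f (Classical.choose h)).toList ρ
        (afterRound f (Classical.choose h) fun ρ' => roundTree f r ρ')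
    else leaf false

/-- **Depth**: "Since **A** runs for at most `bs(f)` stages and each stage queries at most
`C⁽¹⁾(f)` variables, **A** queries at most `C⁽¹⁾(f) bs(f)` variables" — with `r` rounds the tree
has depth `≤ r · C⁽¹⁾(f)`. [cite: BealsEtAl2001, Lemma 5.3 (proof)] -/
theorem depth_roundTree_le (f : (Fin N → Bool) → Bool) :
    ∀ (r : ℕ) (ρ : Fin N → Option Bool), (roundTree f r ρ).depth ≤ r * oneCertificateComplexity f
  | 0, ρ => by simp [roundTree]
  | r + 1, ρ => by
    rw [roundTree]
    split_ifs with h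
    · obtain ⟨-, hfz⟩ := Classical.choose_spec h
      refine (depth_queryBlock_le (d := r * oneCertificateComplexity f) _ _ _ fun ρ' => ?_).trans ?_
      · unfold afterRound
        split_ifs
        · simp
        · exact depth_roundTree_le f r ρ'
      · rw [Finset.length_toList, (minCert_spec f _).2, Nat.succ_mul]
        have := certificateComplexityAt_le_one hfz
        omega
    · simp

/-! ### Correctness -/

/-- The invariant of the correctness proof with `r` rounds left: every consistent input `Y` with
`f(Y) = 0` has at most `r` pairwise disjoint sensitive blocks avoiding the known variables.
[cite: BealsEtAl2001, Lemma 5.3 (proof)] -/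
def RoundInv (f : (Fin N → Bool) → Bool) (r : ℕ) (ρ : Fin N → Option Bool) : Prop :=
  ∀ y, Consistent y ρ → f y = false → ∀ 𝓑 : Finset (Finset (Fin N)), IsSensitiveFamily f y 𝓑 →
    (∀ B ∈ 𝓑, Disjoint B (knownSet ρ)) → 𝓑.card ≤ r

/-- Initially the invariant holds with `r = bs(f)` rounds. [cite: BealsEtAl2001, Def 4.11] -/
theorem roundInv_blockSensitivity (f : (Fin N → Bool) → Bool) :
    RoundInv f (blockSensitivity f) (fun _ => none) :=
  fun _ _ _ _ h𝓑 _ => h𝓑.card_le_blockSensitivity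

/-- A consistent `0`-input and a consistent `1`-input give one sensitive block avoiding the known
variables (their difference set; "`Y'` contains a consistent `1`-certificate `C_{b+1}`").
[cite: BealsEtAl2001, Lemma 5.3 (proof)] -/
theorem RoundInv.false_of_ne {f : (Fin N → Bool) → Bool} {ρ : Fin N → Option Bool}
    (h : RoundInv f 0 ρ) {y y' : Fin N → Bool} (hy : Consistent y ρ) (hy' : Consistent y' ρ)
    (hfy : f y = false) (hfy' : f y' = true) : False := by
  have hfam : IsSensitiveFamily f y {diffSet y y'} := by
    refine ⟨fun B hB => ?_, by simp⟩
    rw [Finset.mem_singleton.mp hB]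
    unfold IsSensitiveBlock
    rw [flipBlock_diffSet, hfy, hfy']
    decide
  have havoid : ∀ B ∈ ({diffSet y y'} : Finset (Finset (Fin N))), Disjoint B (knownSet ρ) := by
    intro B hB
    rw [Finset.mem_singleton.mp hB, Finset.disjoint_left]
    intro i hi hik
    exact mem_diffSet.mp hi (hy'.eq_of_mem_knownSet hy hik)
  have := h y hy hfy {diffSet y y'} hfam havoid
  simp at this

/-- With no round left all consistent inputs have the same `f`-value ("Accordingly, all
consistent `Y` in step 2 must have the same `f`-value"). [cite: BealsEtAl2001, Lemma 5.3 (proof)]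
-/
theorem RoundInv.eq_of_zero {f : (Fin N → Bool) → Bool} {ρ : Fin N → Option Bool}
    (h : RoundInv f 0 ρ) {y y' : Fin N → Bool} (hy : Consistent y ρ) (hy' : Consistent y' ρ) :
    f y = f y' := by
  cases hfy : f y <;> cases hfy' : f y'
  · rfl
  · exact (h.false_of_ne hy hy' hfy hfy').elim
  · exact (h.false_of_ne hy' hy hfy' hfy).elim
  · rfl

/-- **One round preserves the invariant**: if the answers of `x` to the certificate `C` of the
consistent `1`-input `z` are recorded, every consistent `0`-input `Y` acquires the fresh
sensitive block `B = {v ∈ C : Y(v) ≠ C(v)}` ("`Y^{B_i}` agrees with `C_i`, so `f(Y^{B_i}) = 1`";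
`B` lies inside the newly known variables and avoids the previously known ones, "hence all `B_i`
and `B_j` are disjoint"), so the bound on further blocks drops by one. [cite: BealsEtAl2001, Lemma
5.3 (proof)] -/
theorem roundInv_assign {f : (Fin N → Bool) → Bool} {r : ℕ} {ρ : Fin N → Option Bool}
    (hinv : RoundInv f (r + 1) ρ) {x z : Fin N → Bool} (hx : Consistent x ρ) (hz : Consistent z ρ)
    (hfz : f z = true) : RoundInv f r (assign x (minCert f z).toList ρ) := by
  intro y hy hfy 𝓑 h𝓑 hdisj
  set S := minCert f z with hS
  set B₀ := S.filter fun i => y i ≠ z i with hB₀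
  have hyρ : Consistent y ρ := hy.of_assign hx
  -- `Y^{B₀}` agrees with the certificate, so `B₀` is sensitive for `y`
  have hflip : ∀ i ∈ S, flipBlock y B₀ i = z i := by
    intro i hi
    by_cases hyz : y i = z i
    · rw [flipBlock_apply_of_not_mem (by simp [hB₀, hyz]), hyz]
    · rw [flipBlock_apply_of_mem (by simp [hB₀, hi, hyz])]
      revert hyz
      cases y i <;> cases z i <;> simp
  have hsens : IsSensitiveBlock f y B₀ := by
    unfold IsSensitiveBlock
    rw [(minCert_spec f z).1 _ hflip, hfz, hfy]
    decide
  -- `B₀` lies inside the newly known variables and avoids the old ones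
  have hB₀sub : B₀ ⊆ knownSet (assign x S.toList ρ) := fun i hi =>
    mem_knownSet_assign (Finset.mem_toList.mpr (Finset.mem_filter.mp hi).1)
  have hB₀ρ : Disjoint B₀ (knownSet ρ) := Finset.disjoint_left.mpr fun i hi hik =>
    (Finset.mem_filter.mp hi).2 (hyρ.eq_of_mem_knownSet hz hik)
  have hB₀not : B₀ ∉ 𝓑 := fun hmem => by
    obtain ⟨i, hi⟩ := hsens.nonempty
    exact Finset.disjoint_left.mp (hdisj B₀ hmem) hi (hB₀sub hi)
  -- so `B₀` extends the family
  have hfam : IsSensitiveFamily f y (insert B₀ 𝓑) := by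
    refine ⟨fun B hB => ?_, ?_⟩
    · rcases Finset.mem_insert.mp hB with rfl | hB
      · exact hsens
      · exact h𝓑.1 B hB
    · rw [Finset.coe_insert]
      refine h𝓑.2.insert fun B hB _ => ?_
      exact ((hdisj B hB).symm.mono_left hB₀sub :)
  have havoid : ∀ B ∈ insert B₀ 𝓑, Disjoint B (knownSet ρ) := by
    intro B hB
    rcases Finset.mem_insert.mp hB with rfl | hB
    · exact hB₀ρ
    · exact (hdisj B hB).mono_right (knownSet_subset_assign x S.toList ρ)
  have := hinv y hyρ hfy (insert B₀ 𝓑) hfam havoid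
  rw [Finset.card_insert_of_notMem hB₀not] at this
  omega

/-- **Correctness of A**: under the invariant, the tree with `r` rounds left computes `f` on every
consistent input. [cite: BealsEtAl2001, Lemma 5.3 (proof)] -/
theorem eval_roundTree (f : (Fin N → Bool) → Bool) :
    ∀ (r : ℕ) (ρ : Fin N → Option Bool) (x : Fin N → Bool), Consistent x ρ → RoundInv f r ρ →
      (roundTree f r ρ).eval x = f x
  | 0, ρ, x, hx, hinv => by
    rw [roundTree, eval_leaf]
    exact hinv.eq_of_zero (consistent_fill ρ) hx
  | r + 1, ρ, x, hx, hinv => by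
    rw [roundTree]
    split_ifs with h
    · -- a consistent `1`-input `z` exists; query its certificate
      obtain ⟨hz, hfz⟩ := Classical.choose_spec h
      rw [eval_queryBlock, afterRound]
      split_ifs with hagree
      · -- "X is found to agree with a particular 1-certificate C"
        rw [eval_leaf, eq_comm, ← hfz]
        refine (minCert_spec f _).1 x fun i hi => ?_
        have h1 := hagree i hi
        have h2 : assign x (minCert f (Classical.choose h)).toList ρ i = some (x i) := by
          simp [assign, hi]
        rw [h2] at h1
        exact Option.some_injective _ h1
      · exact eval_roundTree f r _ x (consistent_assign_self hx _)
          (roundInv_assign hinv hx hz hfz)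
    · -- "there are no consistent 1-certificates left (and hence f(X) must be 0)"
      rw [eval_leaf, eq_comm]
      by_contra hfx
      exact h ⟨x, hx, by simpa using hfx⟩

end CertificateAlgorithm

/-! ### Lemma 5.3 and `D(f) ≤ bs(f)³` -/

/-- **Beals et al. Lemma 5.3** (after Nisan 1991; Buhrman–de Wolf 2002, Thm. 11):
`D(f) ≤ C⁽¹⁾(f) · bs(f)` for every total Boolean function `f`. [cite: BealsEtAl2001, Lemma 5.3] -/
theorem detQueryComplexity_le_oneCertificateComplexity_mul_blockSensitivity
    (f : (Fin N → Bool) → Bool) :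
    detQueryComplexity f ≤ oneCertificateComplexity f * blockSensitivity f := by
  have hcomp : (CertificateAlgorithm.roundTree f (blockSensitivity f) fun _ => none).Computes f :=
    fun x => CertificateAlgorithm.eval_roundTree f _ _ x (CertificateAlgorithm.consistent_none x)
      (CertificateAlgorithm.roundInv_blockSensitivity f)
  calc detQueryComplexity f
      ≤ (CertificateAlgorithm.roundTree f (blockSensitivity f) fun _ => none).depth :=
        detQueryComplexity_le_depth _ hcomp
    _ ≤ blockSensitivity f * oneCertificateComplexity f :=
        CertificateAlgorithm.depth_roundTree_le f _ _
    _ = oneCertificateComplexity f * blockSensitivity f := mul_comm _ _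

/-- **`D(f) ≤ bs(f)³`** ("The previous two lemmas imply `D(f) ≤ bs(f)³`": Lemma 5.3 with Nisan's
`C⁽¹⁾(f) ≤ C(f) ≤ bs(f)²`, Lemma 5.2; Buhrman–de Wolf 2002, Cor. 1). [cite: BealsEtAl2001, §5
(Lemmas 5.2, 5.3)] -/
theorem detQueryComplexity_le_blockSensitivity_pow_three (f : (Fin N → Bool) → Bool) :
    detQueryComplexity f ≤ blockSensitivity f ^ 3 :=
  calc detQueryComplexity f ≤ oneCertificateComplexity f * blockSensitivity f :=
      detQueryComplexity_le_oneCertificateComplexity_mul_blockSensitivity f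
    _ ≤ certificateComplexity f * blockSensitivity f :=
      Nat.mul_le_mul_right _ (oneCertificateComplexity_le f)
    _ ≤ blockSensitivity f ^ 2 * blockSensitivity f :=
      Nat.mul_le_mul_right _ (certificateComplexity_le_sq f)
    _ = blockSensitivity f ^ 3 := by ring

end Literature.Computability.Complexity
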